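import Literature.AlgebraicGeometry.ProjectiveSpace.CoverIdealSymbolicPowers
import Literature.AlgebraicGeometry.ProjectiveSpace.InducedSubgraphCoverIdealPowers
import Literature.AlgebraicGeometry.ProjectiveSpace.EdgeCoverIdealAssociatedPrimes
import HarnessLib

/-!
# The symbolic powers `J(G)^{(n)}` have no embedded primes: `Ass(S/J(G)^{(n)})` is the set of edge
# primes for every `n ≥ 1`
# (Carlini–Hà–Harbourne–Van Tuyl, Definition 10.1 and Theorem 10.4 (ii); Herzog–Hibi–Trung, §1)

Topic `Literature/AlgebraicGeometry/ProjectiveSpace`, namespace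
`Literature.AlgebraicGeometry.ProjectiveSpace`. Lane `lit-hodgefound`, seat `lit-hodgefound-p32`,
row gen31-#18. Theorems only (no `def`, no named fact). Uses `CoverIdealSymbolicPowers` (gen31-#15:
`J(G)^{(n)} = ⋂_{u ∼ v} (x_u, x_v)^n`, monomial criterion, term property), `CoverIdealPowersEdgePrimes`
(gen31-#10: the minimal primes of `J(G)`), `MonomialIdealAssociatedPrimes` (gen31-#11: Lemma 2.4),
`EdgeCoverIdealAssociatedPrimes` (gen31-#13: `Ass(S/J(G))`).

## The sources, as printed

E. Carlini, H. T. Hà, B. Harbourne, A. Van Tuyl, *Ideals of Powers and Powers of Ideals*, §10.1,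
**Definition 10.1** "the `m`-th symbolic power of `I` is the ideal `I^{(m)} = ⋂_{P ∈ ass(I)} (I^m R_P ∩
R)`"; **Theorem 10.4** "(ii) … the `m`-th symbolic power of `I` is given by `I^{(m)} = P_1^m ∩ ⋯ ∩
P_s^m`." J. Herzog, T. Hibi, N. V. Trung, *Symbolic powers of monomial ideals and vertex cover
algebras*, §1: "If `P` is a prime ideal, then the `P`-primary component of `P^n` is called the `n`th
symbolic power of `P`". Contrast: Carlini et al., **Theorem 2.43**/**Example 2.42**: `Ass(J(G)^2)`
contains the primes of the induced odd cycles.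

## What is here

`J(G)^{(n)} = ⋂_{u ∼ v} (x_u, x_v)^n` (Theorem 10.4 (ii) form), any field `k`.

* § 1 `√(J(G)^{(n)}) = J(G)` and **the minimal primes of `J(G)^{(n)}` are the edge primes, which are
  therefore associated** (`n ≥ 1`).
* § 2 **every associated prime of `S/J(G)^{(n)}` is an edge prime** — by Lemma 2.4 (gen31-#11) an
  associated prime is a variable prime `(x_i : i ∈ B)` with a monomial witness `x^a`; a deficient
  edge `{u, v}` of `a` (`a_u + a_v < n`) forces `B ⊆ {u, v}`, and the products `∏_{w ≠ u} x_w^n`,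
  `∏_{w ≠ v} x_w^n` force `u, v ∈ B`.
* § 3 **`Ass(S/J(G)^{(n)}) = {(x_u, x_v) : u ∼ v}` for all `n ≥ 1`: the symbolic powers have no
  embedded primes**, in contrast with `Ass(S/J(G)^n)` (gen31-#9/#12: the primes of induced odd cycles
  are embedded primes of `J(G)^2`); e.g. `𝔪 ∉ Ass(S/J(C_n)^{(2)})` while `𝔪 ∈ Ass(S/J(C_n)^2)`.

## References

* [CarliniEtAl2020] E. Carlini, H. T. Hà, B. Harbourne, A. Van Tuyl, *Ideals of Powers and Powers of
  Ideals*, LN UMI 27, Springer 2020, Def. 10.1, Thm. 10.4, Thm. 2.43, Example 2.42.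
* [HerzogHibiTrung2007] J. Herzog, T. Hibi, N. V. Trung, *Symbolic powers of monomial ideals and
  vertex cover algebras*, Adv. Math. 210 (2007), §1 and Lemma 4.1.
-/

noncomputable section

open Finset MvPolynomial
open Literature.RingTheory.MvPolynomial

universe u

namespace Literature.AlgebraicGeometry.ProjectiveSpace

variable {σ : Type*} [Fintype σ] [DecidableEq σ] (G : SimpleGraph σ)
variable {k : Type u} [Field k]

/-! ### § 1 Radical and minimal primes of `J(G)^{(n)}` -/

omit [DecidableEq σ] in
/-- `J(G)^{(n)}` as a `Finset.inf` over the ordered edges. [cite: CarliniEtAl2020, Thm. 10.4 (ii)] -/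
theorem symbolicCoverIdeal_eq_finsetInf [DecidableRel G.Adj] (n : ℕ) :
    (⨅ p ∈ {p : σ × σ | G.Adj p.1 p.2}, (Ideal.span ({X p.1, X p.2} : Set (MvPolynomial σ k))) ^ n) =
      (univ.filter (fun p : σ × σ => G.Adj p.1 p.2)).inf
        (fun p => (Ideal.span ({X p.1, X p.2} : Set (MvPolynomial σ k))) ^ n) := by
  rw [Finset.inf_eq_iInf]
  apply iInf_congr fun p => ?_
  simp only [Set.mem_setOf_eq, Finset.mem_filter, Finset.mem_univ, true_and]

omit [DecidableEq σ] in
/-- **`√(J(G)^{(n)}) = J(G) = ⋂_{u ∼ v} (x_u, x_v)`** for `n ≥ 1`.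
[cite: CarliniEtAl2020, Thm. 10.4 (i)–(ii)] -/
theorem radical_symbolicCoverIdeal {n : ℕ} (hn : n ≠ 0) :
    (⨅ p ∈ {p : σ × σ | G.Adj p.1 p.2}, (Ideal.span ({X p.1, X p.2} : Set (MvPolynomial σ k))) ^ n).radical =
      ⨅ p ∈ {p : σ × σ | G.Adj p.1 p.2}, Ideal.span ({X p.1, X p.2} : Set (MvPolynomial σ k)) := by
  classical
  rw [symbolicCoverIdeal_eq_finsetInf, coverIdeal_eq_finsetInf, ← Ideal.radicalInfTopHom_apply,
    map_finset_inf]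
  refine Finset.inf_congr rfl fun p _ => ?_
  rw [Function.comp_apply, Ideal.radicalInfTopHom_apply, Ideal.radical_pow _ hn,
    (isPrime_span_pair_X p.1 p.2).radical]

omit [DecidableEq σ] in
/-- **The minimal primes of `J(G)^{(n)}` (`n ≥ 1`) are the edge primes `(x_u, x_v)`.**
[cite: CarliniEtAl2020, Thm. 10.4 (ii) and Def. 10.1] -/
theorem minimalPrimes_symbolicCoverIdeal {n : ℕ} (hn : n ≠ 0) :
    (⨅ p ∈ {p : σ × σ | G.Adj p.1 p.2},
        (Ideal.span ({X p.1, X p.2} : Set (MvPolynomial σ k))) ^ n).minimalPrimes =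
      (fun p : σ × σ => Ideal.span ({X p.1, X p.2} : Set (MvPolynomial σ k))) '' {p : σ × σ | G.Adj p.1 p.2} := by
  rw [← Ideal.radical_minimalPrimes, radical_symbolicCoverIdeal G hn, minimalPrimes_coverIdeal]

omit [DecidableEq σ] in
/-- Hence every edge prime is an associated prime of `S/J(G)^{(n)}` (`n ≥ 1`).
[cite: CarliniEtAl2020, Def. 10.1 and Thm. 10.4 (ii)] -/
theorem isAssociatedPrime_span_pair_symbolicCoverIdeal {u v : σ} (huv : G.Adj u v) {n : ℕ} (hn : n ≠ 0) :
    IsAssociatedPrime (Ideal.span ({X u, X v} : Set (MvPolynomial σ k)))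
      (MvPolynomial σ k ⧸ ⨅ p ∈ {p : σ × σ | G.Adj p.1 p.2},
        (Ideal.span ({X p.1, X p.2} : Set (MvPolynomial σ k))) ^ n) := by
  apply isAssociatedPrime_quotient_of_mem_minimalPrimes
  rw [minimalPrimes_symbolicCoverIdeal G hn]
  exact ⟨(u, v), huv, rfl⟩

/-! ### § 2 Every associated prime of `S/J(G)^{(n)}` is an edge prime -/

omit [Fintype σ] [DecidableEq σ] in
/-- `x_i · x^a = x^{e_i + a}`. [folklore] -/
private theorem X_mul_monomial_one (i : σ) (a : σ →₀ ℕ) :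
    (X i : MvPolynomial σ k) * monomial a 1 = monomial (Finsupp.single i 1 + a) 1 := by
  rw [← pow_one (X i), ← monomial_single_add]

omit [Fintype σ] in
/-- For a witness `x^a` of `Q = J(G)^{(n)} : x^a` and a deficient edge `{u, v}` (`a_u + a_v < n`):
a variable `x_i ∈ Q` must be `x_u` or `x_v`. [cite: CarliniEtAl2020, Thm. 10.4 (ii) (via Lemma 2.4)] -/
theorem mem_pair_of_X_mem_colon_symbolicCoverIdeal {n : ℕ} {a : σ →₀ ℕ} {u v i : σ} (huv : G.Adj u v)
    (hdef : a u + a v < n)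
    (hi : (X i : MvPolynomial σ k) ∈ Submodule.colon (⨅ p ∈ {p : σ × σ | G.Adj p.1 p.2},
      (Ideal.span ({X p.1, X p.2} : Set (MvPolynomial σ k))) ^ n) {(monomial a (1 : k))}) :
    i = u ∨ i = v := by
  rw [Submodule.mem_colon_singleton, smul_eq_mul, X_mul_monomial_one,
    monomial_mem_symbolicCoverIdeal_iff] at hi
  have h := hi u v huv
  simp only [Finsupp.add_apply, Finsupp.single_apply] at h
  by_contra hnot
  push Not at hnot
  rw [if_neg hnot.1, if_neg hnot.2] at h
  omega

/-- For a witness `x^a` with `Q = J(G)^{(n)} : x^a` prime and a deficient edge `{u, v}`: `x_v ∈ Q`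
(test with `∏_{w ≠ u} x_w^n`, which raises every edge to order `n`).
[cite: CarliniEtAl2020, Thm. 10.4 (ii) (via Lemma 2.4)] -/
theorem X_mem_colon_symbolicCoverIdeal_of_deficient {n : ℕ} {a : σ →₀ ℕ} {u v : σ} (huv : G.Adj u v)
    (hdef : a u + a v < n) {Q : Ideal (MvPolynomial σ k)} (hQ : Q.IsPrime)
    (h : Submodule.colon (⨅ p ∈ {p : σ × σ | G.Adj p.1 p.2},
      (Ideal.span ({X p.1, X p.2} : Set (MvPolynomial σ k))) ^ n) {(monomial a (1 : k))} = Q) :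
    (X v : MvPolynomial σ k) ∈ Q := by
  haveI := hQ
  -- `g = ∏_{w ≠ u} x_w^n` multiplies `x^a` into `J(G)^{(n)}`
  have hg : (∏ w ∈ univ.erase u, (X w : MvPolynomial σ k) ^ n) ∈ Q := by
    rw [← h, Submodule.mem_colon_singleton, smul_eq_mul, Finset.prod_pow,
      prod_X_eq_monomial_sum_single, monomial_pow, one_pow, monomial_mul, one_mul,
      monomial_mem_symbolicCoverIdeal_iff]
    intro u' v' hu'v'
    rw [Finsupp.add_apply, Finsupp.add_apply, smul_sum_single_apply_eq_ite, smul_sum_single_apply_eq_ite]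
    have hne : u' ≠ v' := G.ne_of_adj hu'v'
    by_cases hu' : u' = u
    · have hv'mem : v' ∈ univ.erase u := Finset.mem_erase.mpr ⟨fun h => hne (hu'.trans h.symm), mem_univ _⟩
      rw [if_pos hv'mem]
      omega
    · rw [if_pos (Finset.mem_erase.mpr ⟨hu', mem_univ _⟩)]
      omega
  obtain ⟨w, hw, hwQ⟩ := Ideal.IsPrime.prod_mem_iff.mp hg
  have hwX : (X w : MvPolynomial σ k) ∈ Q := hQ.mem_of_pow_mem _ hwQ
  rcases mem_pair_of_X_mem_colon_symbolicCoverIdeal G huv hdef (h ▸ hwX) with rfl | rfl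
  · exact absurd rfl (Finset.mem_erase.mp hw).1
  · exact hwX

/-- **Every associated prime of `S/J(G)^{(n)}` is an edge prime `(x_u, x_v)`, `u ∼ v`.**
[cite: CarliniEtAl2020, Def. 10.1 and Thm. 10.4 (ii); HerzogHibiTrung2007, §1] -/
theorem exists_eq_span_pair_of_isAssociatedPrime_symbolicCoverIdeal {n : ℕ} {Q : Ideal (MvPolynomial σ k)}
    (hQ : IsAssociatedPrime Q (MvPolynomial σ k ⧸ ⨅ p ∈ {p : σ × σ | G.Adj p.1 p.2},
      (Ideal.span ({X p.1, X p.2} : Set (MvPolynomial σ k))) ^ n)) :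
    ∃ u v : σ, G.Adj u v ∧ Q = Ideal.span ({X u, X v} : Set (MvPolynomial σ k)) := by
  have hI := monomial_mem_symbolicCoverIdeal_of_mem_support G (k := k) n
  have hprime : Q.IsPrime := hQ.isPrime
  obtain ⟨a, hanot, ha⟩ := exists_colon_monomial_eq_of_isAssociatedPrime hI hQ
  have hQvars := eq_span_X_image_of_isAssociatedPrime hI hQ
  -- a deficient edge
  rw [monomial_mem_symbolicCoverIdeal_iff] at hanot
  push Not at hanot
  obtain ⟨u, v, huv, hdef⟩ := hanot
  have hv : (X v : MvPolynomial σ k) ∈ Q := X_mem_colon_symbolicCoverIdeal_of_deficient G huv hdef hprime ha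
  have hu : (X u : MvPolynomial σ k) ∈ Q :=
    X_mem_colon_symbolicCoverIdeal_of_deficient G huv.symm (by rwa [add_comm]) hprime ha
  refine ⟨u, v, huv, ?_⟩
  rw [hQvars, span_pair_X_eq_span_image]
  congr 1
  apply congrArg
  ext i
  simp only [Set.mem_setOf_eq, Set.mem_insert_iff, Set.mem_singleton_iff]
  constructor
  · intro hi
    exact mem_pair_of_X_mem_colon_symbolicCoverIdeal G huv hdef (ha ▸ hi)
  · rintro (rfl | rfl)
    · exact hu
    · exact hv

/-! ### § 3 `Ass(S/J(G)^{(n)})` is the set of edge primes -/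

/-- **`Ass(S/J(G)^{(n)}) = {(x_u, x_v) : u ∼ v}` for every `n ≥ 1`: the symbolic powers of the
cover ideal have no embedded primes** (whereas `J(G)^2` acquires the primes of the induced odd
cycles, Theorem 2.43). [cite: CarliniEtAl2020, Def. 10.1, Thm. 10.4 (ii), Thm. 2.43] -/
theorem isAssociatedPrime_symbolicCoverIdeal_iff {n : ℕ} (hn : n ≠ 0) (Q : Ideal (MvPolynomial σ k)) :
    IsAssociatedPrime Q (MvPolynomial σ k ⧸ ⨅ p ∈ {p : σ × σ | G.Adj p.1 p.2},
        (Ideal.span ({X p.1, X p.2} : Set (MvPolynomial σ k))) ^ n) ↔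
      ∃ u v : σ, G.Adj u v ∧ Q = Ideal.span ({X u, X v} : Set (MvPolynomial σ k)) := by
  refine ⟨exists_eq_span_pair_of_isAssociatedPrime_symbolicCoverIdeal G, ?_⟩
  rintro ⟨u, v, huv, rfl⟩
  exact isAssociatedPrime_span_pair_symbolicCoverIdeal G huv hn

/-- `Ass(S/J(G)^{(n)}) = Ass(S/J(G))` for all `n ≥ 1`. [cite: CarliniEtAl2020, Def. 10.1 and Thm. 1.1] -/
theorem isAssociatedPrime_symbolicCoverIdeal_iff_one {n : ℕ} (hn : n ≠ 0) (Q : Ideal (MvPolynomial σ k)) :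
    IsAssociatedPrime Q (MvPolynomial σ k ⧸ ⨅ p ∈ {p : σ × σ | G.Adj p.1 p.2},
        (Ideal.span ({X p.1, X p.2} : Set (MvPolynomial σ k))) ^ n) ↔
      IsAssociatedPrime Q (MvPolynomial σ k ⧸ ⨅ p ∈ {p : σ × σ | G.Adj p.1 p.2},
        Ideal.span ({X p.1, X p.2} : Set (MvPolynomial σ k))) := by
  rw [isAssociatedPrime_symbolicCoverIdeal_iff G hn, isAssociatedPrime_coverIdeal_iff]

/-- **A variable prime on at least three vertices is never associated to `S/J(G)^{(n)}`** — so the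
prime of an induced odd cycle, an embedded prime of `J(G)^2` (Theorem 2.43 (ii)), is not one of
`J(G)^{(2)}`. [cite: CarliniEtAl2020, Thm. 10.4 (ii) and Example 2.42] -/
theorem not_isAssociatedPrime_span_X_image_symbolicCoverIdeal {n : ℕ} {A : Set σ} {a b c : σ}
    (ha : a ∈ A) (hb : b ∈ A) (hc : c ∈ A) (hab : a ≠ b) (hac : a ≠ c) (hbc : b ≠ c) :
    ¬ IsAssociatedPrime (Ideal.span ((X : σ → MvPolynomial σ k) '' A))
      (MvPolynomial σ k ⧸ ⨅ p ∈ {p : σ × σ | G.Adj p.1 p.2},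
        (Ideal.span ({X p.1, X p.2} : Set (MvPolynomial σ k))) ^ n) := by
  intro h
  obtain ⟨u, v, -, heq⟩ := exists_eq_span_pair_of_isAssociatedPrime_symbolicCoverIdeal G h
  have hA := eq_pair_of_span_X_image_eq_span_pair heq
  rw [hA] at ha hb hc
  simp only [Set.mem_insert_iff, Set.mem_singleton_iff] at ha hb hc
  rcases ha with rfl | rfl <;> rcases hb with rfl | rfl <;> rcases hc with rfl | rfl <;>
    first | exact hab rfl | exact hac rfl | exact hbc rfl

/-- **For an odd cycle `C_m` (`m ≥ 3`): `𝔪 ∉ Ass(S/J(C_m)^{(2)})`, although `𝔪 ∈ Ass(S/J(C_m)^2)`**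
(gen31-#9). [cite: CarliniEtAl2020, Example 2.42 and Thm. 10.4 (ii)] -/
theorem span_range_X_symbolic_vs_ordinary_cycleGraph [Infinite k] {m : ℕ} (hm : Odd m) (h3 : 3 ≤ m) :
    ¬ IsAssociatedPrime (Ideal.span (Set.range (X : Fin m → MvPolynomial (Fin m) k)))
        (MvPolynomial (Fin m) k ⧸ ⨅ p ∈ {p : Fin m × Fin m | (SimpleGraph.cycleGraph m).Adj p.1 p.2},
          (Ideal.span ({X p.1, X p.2} : Set (MvPolynomial (Fin m) k))) ^ 2) ∧
      IsAssociatedPrime (Ideal.span (Set.range (X : Fin m → MvPolynomial (Fin m) k)))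
        (MvPolynomial (Fin m) k ⧸ (⨅ p ∈ {p : Fin m × Fin m | (SimpleGraph.cycleGraph m).Adj p.1 p.2},
          Ideal.span ({X p.1, X p.2} : Set (MvPolynomial (Fin m) k))) ^ 2) := by
  refine ⟨?_, ?_⟩
  · rw [← Set.image_univ]
    have h01 : (⟨0, by omega⟩ : Fin m) ≠ ⟨1, by omega⟩ := by simp
    have h02 : (⟨0, by omega⟩ : Fin m) ≠ ⟨2, by omega⟩ := by simp
    have h12 : (⟨1, by omega⟩ : Fin m) ≠ ⟨2, by omega⟩ := by simp
    exact not_isAssociatedPrime_span_X_image_symbolicCoverIdeal (SimpleGraph.cycleGraph m)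
      (Set.mem_univ _) (Set.mem_univ _) (Set.mem_univ _) h01 h02 h12
  · rw [coverIdeal_eq_span_vertexCovers]
    exact isAssociatedPrime_span_range_X_coverIdeal_cycleGraph_sq hm h3

end Literature.AlgebraicGeometry.ProjectiveSpace
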